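import Summits.CriticalPhenomena.PercolationContinuityZ3.Theorems.PercNearOneGluingNoHeavyLowerTailBlockQ9Certificate
import Summits.CriticalPhenomena.PercolationContinuityZ3.Theorems.PercNearOneGluingAdditiveGluingGoodStepCornerAux
import HarnessLib

/-!
# `NoHeavyLowerTail` (stmt-CriticalPhenomena-4575) — Kozma–Nitzan (41) for a block from the block inequalities of
# its LAYERS (σ-decomposition), and the depth-two corollaries

Support file (hull-port / coupling seat `prim-hp-1` gen 7; `--supports stmt-CriticalPhenomena-4575`).
No definitions, no named facts, no sorries.

* `q9_of_layers` — for ANY block `O` disjoint from `A` and `a, b ∉ O`: if for every layer `S` (a set of vertices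
  outside `O` each receiving a positive pair from `O`) the glued-layer inequality
  `μ_{glue_S kill_O w}(a ↔ b, S ↔ A) ≤ μ_{glue_S kill_O w}(S ↔ b)` holds, then
  `μ_{glue_O w}(a ↔ b, O ↔ A) ≤ μ_{glue_O w}(O ↔ b)` (pre-FKG (41) for the block `O` at the relay `a`).
  This is the layer decomposition of Kozma–Nitzan's σ-recursion (`sigmaRec_partition`, `stub_sigmaGeometry`,
  `stub_sigmaLaw`) read in the (41)-form: the layer `S` of `O` (vertices attached to `O` by open pairs) is a
  glued one-layer-deeper block in the world `kill_O w`.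
* `q9_gluing_of_layers` — the additive-gluing consequence `μ(O ↔ A) − μ(O ↔ b) ≤ 1 − μ(a ↔ b)`.
* `depthTwo_q9_of_hubBlocks` — the case `O = {o}`: for an observer `o ∉ A`, (41) at `a` follows from the block
  inequalities of all hub sets `S` in `kill_{o} w`; these are exactly the statements proved by
  `BlockQ9.blockThm4_witness`, `BlockQ9.blockQ9_oneDangerousPort`, `BlockQ9.blockQ9_step` (for one-layer hub blocks:
  every hub adjacent only to `o` and to relays), so Kozma–Nitzan's Question 9 for a depth-two observer is reduced to
  its glued hub-blocks (memo HULLPORT-COUPLING.md §48: numerically all of them hold; proved when each block has at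
  most one dangerous port, or a peeling certificate).
-/

namespace Summit.CriticalPhenomena.PercolationContinuityZ3.Theorems

open MeasureTheory Set ProbabilityTheory
open Literature.Probability.LatticeModels
open Literature.Probability.Percolation

noncomputable section
open Classical

namespace BlockQ9

variable {n : ℕ}

/-- **(41) for a block from its layers.**  `O` disjoint from `A`, `a, b ∉ O`.  If every layer `S` (vertices outside
`O`, each receiving a positive pair from `O`) satisfies the glued-layer inequality in `kill_O w`, then
`μ_{glue_O w}(a ↔ b, O ↔ A) ≤ μ_{glue_O w}(O ↔ b)`. [cite: KozmaNitzan2024, §3.2 (proofs of Thms 4–5, pp. 13–14)] -/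
theorem q9_of_layers (w : Sym2 (Fin n) → unitInterval) (O A : Finset (Fin n)) (a b : Fin n)
    (hOA : Disjoint O A) (haO : a ∉ O) (hbO : b ∉ O)
    (hlayer : ∀ S : Finset (Fin n), (∀ x ∈ S, x ∉ O ∧ ∃ o ∈ O, w s(o, x) ≠ 0) → S.Nonempty → b ∉ S →
      (prodBernoulli (fun e : Sym2 (Fin n) => if (∀ x ∈ e, x ∈ S) ∧ ¬ e.IsDiag then 1 else
          if (∃ x ∈ e, x ∈ O) then 0 else w e)).real
          (openConn a b ∩ ⋃ s ∈ S, ⋃ x ∈ A, openConn s x) ≤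
        (prodBernoulli (fun e : Sym2 (Fin n) => if (∀ x ∈ e, x ∈ S) ∧ ¬ e.IsDiag then 1 else
          if (∃ x ∈ e, x ∈ O) then 0 else w e)).real (⋃ s ∈ S, openConn s b)) :
    (prodBernoulli (fun e : Sym2 (Fin n) => if (∀ x ∈ e, x ∈ O) ∧ ¬ e.IsDiag then 1 else w e)).real
        (openConn a b ∩ ⋃ o ∈ O, ⋃ x ∈ A, openConn o x) ≤
      (prodBernoulli (fun e : Sym2 (Fin n) => if (∀ x ∈ e, x ∈ O) ∧ ¬ e.IsDiag then 1 else w e)).real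
        (⋃ o ∈ O, openConn o b) := by
  classical
  set g : Sym2 (Fin n) → unitInterval := fun e => if (∀ x ∈ e, x ∈ O) ∧ ¬ e.IsDiag then 1 else w e with hg
  rw [sigmaRec_partition g O (openConn a b ∩ _), sigmaRec_partition g O (⋃ o ∈ O, openConn o b)]
  refine Finset.sum_le_sum fun S _ => ?_
  set L : Set (BondConfig (Fin n)) := {ω | ∀ x : Fin n, x ∈ S ↔ (x ∉ O ∧ ∃ o ∈ O, s(o, x) ∈ ω)} with hL
  set Ψ : BondConfig (Fin n) → BondConfig (Fin n) := fun ω =>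
    ({e | e ∈ ω ∧ ∀ x ∈ e, x ∉ O} ∪ {e | (∀ x ∈ e, x ∈ S) ∧ ¬ e.IsDiag} : BondConfig (Fin n)) with hΨ
  set gS : Sym2 (Fin n) → unitInterval := fun e =>
    if (∀ x ∈ e, x ∈ S) ∧ ¬ e.IsDiag then 1 else if (∃ x ∈ e, x ∈ O) then 0 else w e with hgS
  set K : Set (BondConfig (Fin n)) := {ω | ∀ o ∈ O, ∀ o' ∈ O, o ≠ o' → s(o, o') ∈ ω} with hK
  have hKc : prodBernoulli g Kᶜ = 0 := by
    refine sigmaRec_conull g K fun ω hω => ?_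
    simp only [hK, mem_setOf_eq, not_forall] at hω
    obtain ⟨o, ho, o', ho', hne, hclosed⟩ := hω
    refine ⟨s(o, o'), ?_, hclosed⟩
    simp only [hg]
    rw [if_pos ⟨fun x hx => by rcases Sym2.mem_iff.1 hx with rfl | rfl <;> assumption,
      by rw [Sym2.mk_isDiag_iff]; exact hne⟩]
  have hgeomA : ∀ ω, ω ∈ L → ω ∈ K →
      (ω ∈ (openConn a b ∩ ⋃ o ∈ O, ⋃ x ∈ A, openConn o x : Set (BondConfig (Fin n))) ↔
        ω ∈ Ψ ⁻¹' (openConn a b ∩ ⋃ s ∈ S, ⋃ x ∈ A, openConn s x)) := by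
    intro ω hωL hωK
    obtain ⟨h1, h2⟩ := stub_sigmaGeometry n O S ω hωL hωK
    simp only [mem_preimage, mem_inter_iff]
    exact and_congr (h2 a b haO hbO) (h1 A hOA)
  have hgeomB : ∀ ω, ω ∈ L → ω ∈ K →
      (ω ∈ (⋃ o ∈ O, openConn o b : Set (BondConfig (Fin n))) ↔ ω ∈ Ψ ⁻¹' (⋃ s ∈ S, openConn s b)) := by
    intro ω hωL hωK
    obtain ⟨h1, -⟩ := stub_sigmaGeometry n O S ω hωL hωK
    have hOb : Disjoint O {b} := Finset.disjoint_singleton_right.2 hbO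
    have := h1 {b} hOb
    simp only [Finset.mem_singleton, iUnion_iUnion_eq_left] at this
    simpa only [mem_preimage] using this
  -- null layers
  by_cases hgen : ∀ x ∈ S, x ∉ O ∧ ∃ o ∈ O, w s(o, x) ≠ 0
  swap
  · have hL0 : (prodBernoulli g).real L = 0 := by
      push Not at hgen
      obtain ⟨x, hxS, hx⟩ := hgen
      by_cases hxO : x ∈ O
      · have hLe : L = ∅ := by
          ext ω
          simp only [hL, mem_setOf_eq, mem_empty_iff_false, iff_false]
          intro h
          exact ((h x).1 hxS).1 hxO
        rw [hLe, measureReal_empty]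
      · refine sigmaRec_null g L (O.image fun o => s(o, x)) (fun e he => ?_) (fun ω hω => ?_)
        · obtain ⟨o, ho, rfl⟩ := Finset.mem_image.1 he
          have hw0 : w s(o, x) = 0 := hx hxO o ho
          have hnot : ¬ ((∀ y ∈ s(o, x), y ∈ O) ∧ ¬ (s(o, x)).IsDiag) := fun h =>
            hxO (h.1 x (Sym2.mem_mk_right o x))
          simp only [hg]
          rw [if_neg hnot, hw0]
        · obtain ⟨-, o, ho, hox⟩ := ((hω : ω ∈ L) x |>.1) hxS
          exact ⟨s(o, x), Finset.mem_image.2 ⟨o, ho, rfl⟩, hox⟩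
    calc (prodBernoulli g).real (L ∩ (openConn a b ∩ ⋃ o ∈ O, ⋃ x ∈ A, openConn o x))
        ≤ (prodBernoulli g).real L := measureReal_mono inter_subset_left
      _ = 0 := hL0
      _ ≤ _ := measureReal_nonneg
  rw [sigmaRec_inter_congr g hKc hgeomA, sigmaRec_inter_congr g hKc hgeomB]
  rcases S.eq_empty_or_nonempty with hSe | hSne
  · have h0 : Ψ ⁻¹' (openConn a b ∩ ⋃ s ∈ S, ⋃ x ∈ A, (openConn s x : Set (BondConfig (Fin n)))) = ∅ := by
      rw [hSe]; ext ω; simp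
    rw [h0, inter_empty, measureReal_empty]
    exact measureReal_nonneg
  have hlawA := stub_sigmaLaw n w O S (openConn a b ∩ ⋃ s ∈ S, ⋃ x ∈ A, openConn s x)
  have hlawB := stub_sigmaLaw n w O S (⋃ s ∈ S, openConn s b)
  change (prodBernoulli g).real (L ∩ Ψ ⁻¹' _) = (prodBernoulli g).real L * (prodBernoulli gS).real _ at hlawA
  change (prodBernoulli g).real (L ∩ Ψ ⁻¹' _) = (prodBernoulli g).real L * (prodBernoulli gS).real _ at hlawB
  rw [hlawA, hlawB]
  refine mul_le_mul_of_nonneg_left ?_ measureReal_nonneg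
  by_cases hbS : b ∈ S
  · have h1 : (prodBernoulli gS).real (⋃ s ∈ S, openConn s b) = 1 := by
      have : (⋃ s ∈ S, openConn s b : Set (BondConfig (Fin n))) = univ :=
        eq_univ_of_forall fun ω => mem_iUnion₂.2
          ⟨b, hbS, (SimpleGraph.Reachable.refl b : (openGraph ω).Reachable b b)⟩
      rw [this, probReal_univ]
    rw [h1]; exact measureReal_le_one
  exact hlayer S hgen hSne hbS

/-- **Additive gluing from (41).**  Under the hypotheses of `q9_of_layers`:
`μ_{glue_O w}(O ↔ A) − μ_{glue_O w}(O ↔ b) ≤ 1 − μ_{glue_O w}(a ↔ b)`. [cite: KozmaNitzan2024, inequalities (2)–(3) (p. 3)] -/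
theorem q9_gluing_of_layers (w : Sym2 (Fin n) → unitInterval) (O A : Finset (Fin n)) (a b : Fin n)
    (hOA : Disjoint O A) (haO : a ∉ O) (hbO : b ∉ O)
    (hlayer : ∀ S : Finset (Fin n), (∀ x ∈ S, x ∉ O ∧ ∃ o ∈ O, w s(o, x) ≠ 0) → S.Nonempty → b ∉ S →
      (prodBernoulli (fun e : Sym2 (Fin n) => if (∀ x ∈ e, x ∈ S) ∧ ¬ e.IsDiag then 1 else
          if (∃ x ∈ e, x ∈ O) then 0 else w e)).real
          (openConn a b ∩ ⋃ s ∈ S, ⋃ x ∈ A, openConn s x) ≤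
        (prodBernoulli (fun e : Sym2 (Fin n) => if (∀ x ∈ e, x ∈ S) ∧ ¬ e.IsDiag then 1 else
          if (∃ x ∈ e, x ∈ O) then 0 else w e)).real (⋃ s ∈ S, openConn s b)) :
    (prodBernoulli (fun e : Sym2 (Fin n) => if (∀ x ∈ e, x ∈ O) ∧ ¬ e.IsDiag then 1 else w e)).real
        (⋃ o ∈ O, ⋃ x ∈ A, openConn o x) -
      (prodBernoulli (fun e : Sym2 (Fin n) => if (∀ x ∈ e, x ∈ O) ∧ ¬ e.IsDiag then 1 else w e)).real
        (⋃ o ∈ O, openConn o b) ≤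
      1 - (prodBernoulli (fun e : Sym2 (Fin n) => if (∀ x ∈ e, x ∈ O) ∧ ¬ e.IsDiag then 1 else w e)).real
        (openConn a b) := by
  classical
  set g : Sym2 (Fin n) → unitInterval := fun e => if (∀ x ∈ e, x ∈ O) ∧ ¬ e.IsDiag then 1 else w e with hg
  set U : Set (BondConfig (Fin n)) := ⋃ o ∈ O, ⋃ x ∈ A, openConn o x with hU
  have h := q9_of_layers w O A a b hOA haO hbO hlayer
  have hsplit : (prodBernoulli g).real (U ∩ openConn a b) + (prodBernoulli g).real (U \ openConn a b) =
      (prodBernoulli g).real U :=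
    measureReal_inter_add_sdiff (s := U) (MeasurableSet.of_discrete : MeasurableSet (openConn a b : Set _))
      (h := measure_ne_top _ _)
  have hcompl : (prodBernoulli g).real (U \ openConn a b) ≤ 1 - (prodBernoulli g).real (openConn a b) := by
    have hc : (prodBernoulli g).real ((openConn a b : Set (BondConfig (Fin n)))ᶜ) =
        1 - (prodBernoulli g).real (openConn a b) := by
      rw [measureReal_compl (MeasurableSet.of_discrete), probReal_univ]
    rw [← hc]
    exact measureReal_mono fun ω ⟨_, h2⟩ => h2
  rw [inter_comm] at hsplit
  change (prodBernoulli g).real (openConn a b ∩ U) ≤ (prodBernoulli g).real (⋃ o ∈ O, openConn o b) at h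
  linarith

/-- **Depth-two reduction: Question 9 for an observer from its glued hub-blocks.**  For an observer `o ∉ A` and
relays `a ≠ o`, `b ≠ o`: if for every set `S` of neighbours of `o` (vertices receiving a positive pair from `o`)
the glued block `S` in the graph `kill_{o} w` (the pairs at `o` deleted) satisfies
`μ(a ↔ b, S ↔ A) ≤ μ(S ↔ b)`, then `μ_w(a ↔ b, o ↔ A) ≤ μ_w(o ↔ b)`.  For a depth-two observer (every neighbour of
`o` is a relay or a hub adjacent only to `o` and to relays) the hub-blocks are one-layer and these hypotheses are
the conclusions of `blockThm4_witness` / `blockQ9_oneDangerousPort` / `blockQ9_step`.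
[cite: KozmaNitzan2024, Thm. 5 and Question 9 (pp. 13–14, 36)] -/
theorem depthTwo_q9_of_hubBlocks (w : Sym2 (Fin n) → unitInterval) (A : Finset (Fin n)) (o a b : Fin n)
    (hoA : o ∉ A) (hao : a ≠ o) (hbo : b ≠ o)
    (hlayer : ∀ S : Finset (Fin n), (∀ x ∈ S, x ≠ o ∧ w s(o, x) ≠ 0) → S.Nonempty → b ∉ S →
      (prodBernoulli (fun e : Sym2 (Fin n) => if (∀ x ∈ e, x ∈ S) ∧ ¬ e.IsDiag then 1 else
          if (o ∈ e) then 0 else w e)).real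
          (openConn a b ∩ ⋃ s ∈ S, ⋃ x ∈ A, openConn s x) ≤
        (prodBernoulli (fun e : Sym2 (Fin n) => if (∀ x ∈ e, x ∈ S) ∧ ¬ e.IsDiag then 1 else
          if (o ∈ e) then 0 else w e)).real (⋃ s ∈ S, openConn s b)) :
    (prodBernoulli w).real (openConn a b ∩ ⋃ x ∈ A, openConn o x) ≤ (prodBernoulli w).real (openConn o b) := by
  classical
  have hOA : Disjoint ({o} : Finset (Fin n)) A := Finset.disjoint_singleton_left.2 hoA
  have h := q9_of_layers w {o} A a b hOA (by simpa using hao) (by simpa using hbo) (fun S hS hSne hbS => by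
    have hkill : (fun e : Sym2 (Fin n) => if (∀ x ∈ e, x ∈ S) ∧ ¬ e.IsDiag then (1 : unitInterval) else
        if (∃ x ∈ e, x ∈ ({o} : Finset (Fin n))) then 0 else w e) =
        fun e : Sym2 (Fin n) => if (∀ x ∈ e, x ∈ S) ∧ ¬ e.IsDiag then 1 else if (o ∈ e) then 0 else w e := by
      funext e
      have : (∃ x ∈ e, x ∈ ({o} : Finset (Fin n))) ↔ o ∈ e :=
        ⟨fun ⟨x, hx, hxo⟩ => (Finset.mem_singleton.1 hxo) ▸ hx, fun h => ⟨o, h, Finset.mem_singleton_self o⟩⟩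
      simp only [this]
    rw [hkill]
    exact hlayer S (fun x hx => by
      obtain ⟨hxo, o', ho', hw⟩ := hS x hx
      exact ⟨fun h => hxo (by rw [h]; exact Finset.mem_singleton_self o), by
        rw [Finset.mem_singleton.1 ho'] at hw; exact hw⟩) hSne hbS)
  rw [goodStepCorner_glue_singleton] at h
  simpa only [Finset.mem_singleton, iUnion_iUnion_eq_left] using h

end BlockQ9

end

end Summit.CriticalPhenomena.PercolationContinuityZ3.Theorems
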